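import Summits.Ventures.DiscreteObjects.Hadamard.OrbitRowIdentity

/-!
# Hadamard 668 census, family F12 — no automorphism of prime order p ∈ {43, 53, 59, …, 661} (106 primes), fully in the kernel

Framing: lottery ticket; floor = certified bounds/negative ranges.

Cell pub-namedobj (venture DiscreteObjects), target (H), hadamard gen 5 (FAMILY-F12-G5 §7/§9).  This file removes the
last paper steps for 106 of the 111 excluded primes: starting from an incidence function `N : P → B → ℤ` with values in
{0,1}, constant row sums `333`, inner product `166` between distinct rows (the point half of 'symmetric
2-(667,333,166) design'; `|B| = 667`), and an AUTOMORPHISM — permutations `ρ` of `P`, `τ` of `B` with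
`N (ρ x) (τ y) = N x y` — such that `ρ^p = 1`, `τ^p = 1`, `p` prime, `ρ ≠ 1`, we build the orbit of a moved point, the
`τ`-orbits of the moved blocks (all of length `p`, `orb_card`), verify the tactical-decomposition hypotheses of
`orbitRow_identities` (class-regularity by re-indexing sums along `τ^i`, `ρ^i`; fixed blocks through the base point
contain its orbit), and conclude with Cauchy–Schwarz: for the 106 odd primes `p` of `primes106` (every odd prime in
[43, 661] except 47 and 83) the discriminant `4(333² - m(167 + 166p)) - (666 - m p)²` is positive for EVERY
`1 ≤ m ≤ 667/p` (`primes106_disc`, `decide`), and `m = 0` is impossible by the first identity; no parity theorem or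
fixed-point bound is needed for these primes.  MAIN THEOREM `no_automorphism_primes106`.  (For 29, 31: Lander's parity
theorem is needed; for 17, 19, 47: the fixed-point pair arithmetic of `PrimeOrderFixedPoints`; see FAMILY-F12-G5 §9.)
For a Hadamard matrix of order 668 and `p ∤ 668` an automorphism of odd prime order can be unsigned and fixes a row and
a column, so it induces such a pair `(ρ, τ)` on the normalised core (FAMILY-F12 §6, on paper).
Ours, not literature; no `sorry`; `decide` only for the arithmetic table.
-/

open Finset BigOperators

namespace Summit.Ventures.DiscreteObjects.Hadamard

section perm
variable {α : Type*}

/-- a point fixed by `σ` is fixed by every power -/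
lemma perm_pow_apply_of_fixed (σ : Equiv.Perm α) {a : α} (h : σ a = a) (u : ℕ) : (σ ^ u) a = a := by
  induction u with
  | zero => simp
  | succ u ih => rw [pow_succ, Equiv.Perm.mul_apply, h, ih]

/-- if `σ^p = 1` with `p` prime and `σ a ≠ a`, then `i ↦ σ^i a` is injective on `i < p` -/
lemma perm_pow_apply_injective (σ : Equiv.Perm α) {p : ℕ} (hp : p.Prime) (hσ : σ ^ p = 1) {a : α}
    (ha : σ a ≠ a) {i j : ℕ} (hi : i < p) (hj : j < p) (hij : (σ ^ i) a = (σ ^ j) a) : i = j := by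
  -- reduce to: (σ^d) a = a with d < p forces d = 0
  have key : ∀ d, d < p → (σ ^ d) a = a → d = 0 := by
    intro d hd hfix
    by_contra hne
    have hdpos : 0 < d := Nat.pos_of_ne_zero hne
    have hcop : Nat.Coprime d p := (Nat.coprime_of_lt_prime hdpos.ne' hd hp).symm
    obtain ⟨u, -, hu⟩ := Nat.exists_mul_mod_eq_one_of_coprime hcop hp.one_lt
    have h1 : (σ ^ (d * u)) a = a := by rw [pow_mul]; exact perm_pow_apply_of_fixed _ hfix u
    have h2 : σ ^ (d * u) = σ := by
      rw [← Nat.div_add_mod (d * u) p, pow_add, pow_mul, hσ, one_pow, one_mul, hu, pow_one]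
    rw [h2] at h1
    exact ha h1
  rcases le_total i j with h | h
  · obtain ⟨d, rfl⟩ := Nat.exists_eq_add_of_le h
    have : (σ ^ d) a = a := by
      rw [pow_add, Equiv.Perm.mul_apply] at hij
      exact ((σ ^ i).injective hij).symm
    have hd := key d (by omega) this
    omega
  · obtain ⟨d, rfl⟩ := Nat.exists_eq_add_of_le h
    have : (σ ^ d) a = a := by
      rw [pow_add, Equiv.Perm.mul_apply] at hij
      exact (σ ^ j).injective hij
    have hd := key d (by omega) this
    omega

variable [DecidableEq α]

/-- the orbit `{σ^i a : i < p}` as a finset -/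
def orbFin (σ : Equiv.Perm α) (p : ℕ) (a : α) : Finset α :=
  (Finset.range p).image (fun i => (σ ^ i) a)

/-- the base point lies in its orbit -/
lemma mem_orbFin_self (σ : Equiv.Perm α) {p : ℕ} (hp : 0 < p) (a : α) : a ∈ orbFin σ p a :=
  Finset.mem_image.mpr ⟨0, Finset.mem_range.mpr hp, by simp⟩

/-- every power of `σ` applied to the base point lies in the orbit (indices mod `p`, using `σ^p = 1`) -/
lemma pow_apply_mem_orbFin (σ : Equiv.Perm α) {p : ℕ} (hp : 0 < p) (hσ : σ ^ p = 1) (a : α) (n : ℕ) :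
    (σ ^ n) a ∈ orbFin σ p a := by
  refine Finset.mem_image.mpr ⟨n % p, Finset.mem_range.mpr (Nat.mod_lt _ hp), ?_⟩
  rw [← pow_eq_pow_mod n hσ]

/-- the orbit of a moved point has exactly `p` elements -/
lemma card_orbFin (σ : Equiv.Perm α) {p : ℕ} (hp : p.Prime) (hσ : σ ^ p = 1) {a : α} (ha : σ a ≠ a) :
    (orbFin σ p a).card = p := by
  unfold orbFin
  rw [Finset.card_image_of_injOn, Finset.card_range]
  intro i hi j hj hij
  exact perm_pow_apply_injective σ hp hσ ha (Finset.mem_range.mp hi) (Finset.mem_range.mp hj) hij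

/-- orbits are closed under powers of `σ`: the image of the orbit under `σ^n` is the orbit -/
lemma image_pow_orbFin (σ : Equiv.Perm α) {p : ℕ} (hp : p.Prime) (hσ : σ ^ p = 1) {a : α} (ha : σ a ≠ a)
    (n : ℕ) : (orbFin σ p a).image (σ ^ n) = orbFin σ p a := by
  apply Finset.eq_of_subset_of_card_le
  · intro b hb
    obtain ⟨c, hc, rfl⟩ := Finset.mem_image.mp hb
    obtain ⟨i, hi, rfl⟩ := Finset.mem_image.mp hc
    rw [← Equiv.Perm.mul_apply, ← pow_add]
    exact pow_apply_mem_orbFin σ hp.pos hσ a _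
  · rw [Finset.card_image_of_injective _ (σ ^ n).injective, card_orbFin σ hp hσ ha]

/-- an element of the orbit of a moved point is moved -/
lemma moved_of_mem_orbFin (σ : Equiv.Perm α) {p : ℕ} (hσ : σ ^ p = 1) {a b : α} (ha : σ a ≠ a)
    (hb : b ∈ orbFin σ p a) : σ b ≠ b := by
  intro hfix
  obtain ⟨i, hi, rfl⟩ := Finset.mem_image.mp hb
  have hi' := Finset.mem_range.mp hi
  -- a = σ^(p-i) (σ^i a) is then fixed
  have e : (σ ^ (p - i)) ((σ ^ i) a) = a := by
    rw [← Equiv.Perm.mul_apply, ← pow_add, Nat.sub_add_cancel hi'.le, hσ]; simp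
  have : (σ ^ (p - i)) ((σ ^ i) a) = (σ ^ i) a := perm_pow_apply_of_fixed σ hfix _
  rw [e] at this
  -- so a = σ^i a, hence σ a = σ (σ^i a) = σ^i (σ a)... use fixedness of σ^i a under σ
  apply ha
  calc σ a = σ ((σ ^ i) a) := by rw [← this]
    _ = (σ ^ i) a := hfix
    _ = a := this.symm

/-- the orbit of an element of an orbit is the same orbit -/
lemma orbFin_eq_of_mem (σ : Equiv.Perm α) {p : ℕ} (hp : p.Prime) (hσ : σ ^ p = 1) {a b : α} (ha : σ a ≠ a)
    (hb : b ∈ orbFin σ p a) : orbFin σ p b = orbFin σ p a := by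
  apply Finset.eq_of_subset_of_card_le
  · intro c hc
    obtain ⟨l, hl, rfl⟩ := Finset.mem_image.mp hc
    obtain ⟨i, hi, rfl⟩ := Finset.mem_image.mp hb
    rw [← Equiv.Perm.mul_apply, ← pow_add]
    exact pow_apply_mem_orbFin σ hp.pos hσ a _
  · rw [card_orbFin σ hp hσ ha, card_orbFin σ hp hσ (moved_of_mem_orbFin σ hσ ha hb)]

end perm

/-- the 106 odd primes in [43, 661] other than 47 and 83 -/
def primes106 : List ℕ :=
  [43, 53, 59, 61, 67, 71, 73, 79, 89, 97, 101, 103, 107, 109, 113, 127, 131, 137, 139, 149, 151, 157, 163, 167, 173,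
   179, 181, 191, 193, 197, 199, 211, 223, 227, 229, 233, 239, 241, 251, 257, 263, 269, 271, 277, 281, 283, 293, 307,
   311, 313, 317, 331, 337, 347, 349, 353, 359, 367, 373, 379, 383, 389, 397, 401, 409, 419, 421, 431, 433, 439, 443,
   449, 457, 461, 463, 467, 479, 487, 491, 499, 503, 509, 521, 523, 541, 547, 557, 563, 569, 571, 577, 587, 593, 599,
   601, 607, 613, 617, 619, 631, 641, 643, 647, 653, 659, 661]

set_option maxRecDepth 200000 in
/-- for every listed prime and every orbit number `1 ≤ m ≤ 15` with `m p ≤ 667`: negative discriminant -/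
theorem primes106_disc : ∀ p ∈ primes106, ∀ m ∈ Finset.range 16, 1 ≤ m → m * p ≤ 667 →
    (0 : ℤ) < 4 * (333 ^ 2 - (m : ℤ) * (167 + 166 * (p : ℤ))) - (666 - (m : ℤ) * (p : ℤ)) ^ 2 := by
  decide

set_option maxRecDepth 200000 in
/-- every listed prime is at least 43 (so `m p ≤ 667` gives `m ≤ 15`) -/
lemma primes106_ge : ∀ p ∈ primes106, 43 ≤ p := by decide

/-- **No automorphism of prime order p ∈ primes106.**  See the module docstring. -/
theorem no_automorphism_primes106 {P B : Type*} [Fintype P] [DecidableEq P] [Fintype B] [DecidableEq B]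
    (N : P → B → ℤ) (h01 : ∀ x y, N x y = 0 ∨ N x y = 1)
    (hrow : ∀ x, ∑ y, N x y = 333) (hpair : ∀ x x', x ≠ x' → ∑ y, N x y * N x' y = 166)
    (hB : Fintype.card B = 667)
    (p : ℕ) (hp : p.Prime) (hmem : p ∈ primes106)
    (ρ : Equiv.Perm P) (τ : Equiv.Perm B) (hN : ∀ x y, N (ρ x) (τ y) = N x y)
    (hρ : ρ ^ p = 1) (hτ : τ ^ p = 1) (x₀ : P) (hx₀ : ρ x₀ ≠ x₀) : False := by
  -- iterated compatibility
  have hNi : ∀ i x y, N ((ρ ^ i) x) ((τ ^ i) y) = N x y := by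
    intro i; induction i with
    | zero => intro x y; simp
    | succ i ih => intro x y; rw [pow_succ', pow_succ', Equiv.Perm.mul_apply, Equiv.Perm.mul_apply, hN, ih]
  -- the point orbit
  set O := orbFin ρ p x₀ with hOdef
  have hOcard : O.card = p := card_orbFin ρ hp hρ hx₀
  have hx₀O : x₀ ∈ O := mem_orbFin_self ρ hp.pos x₀
  -- the block classes: τ-orbits of moved blocks
  set T : Finset (Finset B) := (univ.filter (fun y => τ y ≠ y)).image (orbFin τ p) with hTdef
  let cls : B → Option {C // C ∈ T} := fun y =>
    if h : τ y = y then none else some ⟨orbFin τ p y, Finset.mem_image_of_mem _ (Finset.mem_filter.mpr ⟨mem_univ _, h⟩)⟩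
  -- fibres of cls
  have fib_none : univ.filter (fun y => cls y = none) = univ.filter (fun y => τ y = y) := by
    ext y; simp only [Finset.mem_filter, Finset.mem_univ, true_and, cls]
    by_cases h : τ y = y <;> simp [h]
  have fib_some : ∀ C : {C // C ∈ T}, univ.filter (fun y => cls y = some C) = C.1 := by
    rintro ⟨C, hC⟩
    obtain ⟨y₀, hy₀, rfl⟩ := Finset.mem_image.mp hC
    have hy₀' : τ y₀ ≠ y₀ := (Finset.mem_filter.mp hy₀).2
    ext y
    simp only [Finset.mem_filter, Finset.mem_univ, true_and, cls]
    constructor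
    · intro h
      by_cases hy : τ y = y
      · simp [hy] at h
      · simp only [hy, ↓reduceDIte, Option.some.injEq, Subtype.mk.injEq] at h
        rw [← h]; exact mem_orbFin_self τ hp.pos y
    · intro h
      have hy : τ y ≠ y := moved_of_mem_orbFin τ hτ hy₀' h
      simp only [hy, ↓reduceDIte, Option.some.injEq, Subtype.mk.injEq]
      exact orbFin_eq_of_mem τ hp hτ hy₀' h
  -- class representatives are moved and classes have p elements
  have cls_moved : ∀ C : {C // C ∈ T}, ∃ y₀, τ y₀ ≠ y₀ ∧ C.1 = orbFin τ p y₀ := by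
    rintro ⟨C, hC⟩
    obtain ⟨y₀, hy₀, rfl⟩ := Finset.mem_image.mp hC
    exact ⟨y₀, (Finset.mem_filter.mp hy₀).2, rfl⟩
  -- w j := number of blocks of class j through x₀
  let w : {C // C ∈ T} → ℤ := fun C => ∑ y ∈ C.1, N x₀ y
  -- (i) class-regularity on the point side
  have hw : ∀ x ∈ O, ∀ C, ∑ y ∈ univ.filter (fun y => cls y = some C), N x y = w C := by
    intro x hx C
    rw [fib_some C]
    obtain ⟨y₀, hy₀, hCeq⟩ := cls_moved C
    obtain ⟨i, hi, rfl⟩ := Finset.mem_image.mp hx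
    show ∑ y ∈ C.1, N ((ρ ^ i) x₀) y = ∑ y ∈ C.1, N x₀ y
    rw [hCeq, ← image_pow_orbFin τ hp hτ hy₀ i, Finset.sum_image (fun a _ b _ h => (τ ^ i).injective h)]
    rw [image_pow_orbFin τ hp hτ hy₀ i]
    exact Finset.sum_congr rfl fun y _ => hNi i x₀ y
  -- (ii) class-regularity on the block side, via double counting
  have hw' : ∀ C y, cls y = some C → ∑ x ∈ O, N x y = w C := by
    intro C y hy
    have hyC : y ∈ C.1 := by rw [← fib_some C]; exact Finset.mem_filter.mpr ⟨mem_univ _, hy⟩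
    obtain ⟨y₀, hy₀, hCeq⟩ := cls_moved C
    -- constancy along the class: Σ_{x∈O} N x (τ^i y') = Σ_{x∈O} N x y'
    have const : ∀ y' (i : ℕ), ∑ x ∈ O, N x ((τ ^ i) y') = ∑ x ∈ O, N x y' := by
      intro y' i
      rw [hOdef, ← image_pow_orbFin ρ hp hρ hx₀ i, Finset.sum_image (fun a _ b _ h => (ρ ^ i).injective h)]
      rw [image_pow_orbFin ρ hp hρ hx₀ i]
      exact Finset.sum_congr rfl fun x _ => hNi i x y'
    -- every element of the class is τ^i y₀
    have eqcount : ∀ y' ∈ C.1, ∑ x ∈ O, N x y' = ∑ x ∈ O, N x y₀ := by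
      intro y' hy'
      rw [hCeq] at hy'
      obtain ⟨i, hi, rfl⟩ := Finset.mem_image.mp hy'
      exact const y₀ i
    -- double count
    have dc : ∑ y' ∈ C.1, ∑ x ∈ O, N x y' = ∑ x ∈ O, ∑ y' ∈ C.1, N x y' := Finset.sum_comm
    rw [Finset.sum_congr rfl eqcount, Finset.sum_const] at dc
    have hCcard : C.1.card = p := by rw [hCeq]; exact card_orbFin τ hp hτ hy₀
    have inner : ∀ x ∈ O, ∑ y' ∈ C.1, N x y' = w C := by
      intro x hx; rw [← fib_some C]; exact hw x hx C
    rw [Finset.sum_congr rfl inner, Finset.sum_const, hOcard, hCcard] at dc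
    rw [eqcount y hyC]
    have hp0 : (p : ℤ) ≠ 0 := by exact_mod_cast hp.ne_zero
    have : (p : ℤ) * ∑ x ∈ O, N x y₀ = (p : ℤ) * w C := by
      simpa [nsmul_eq_mul] using dc
    exact mul_left_cancel₀ hp0 this
  -- (iii) fixed blocks through x₀ contain the orbit
  have hfix : ∀ y, cls y = none → N x₀ y = 1 → ∀ x ∈ O, N x y = 1 := by
    intro y hy h1 x hx
    have hyfix : τ y = y := by
      have : y ∈ univ.filter (fun y => cls y = none) := Finset.mem_filter.mpr ⟨mem_univ _, hy⟩
      rw [fib_none] at this; exact (Finset.mem_filter.mp this).2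
    obtain ⟨i, hi, rfl⟩ := Finset.mem_image.mp hx
    rw [← perm_pow_apply_of_fixed τ hyfix i, hNi]; exact h1
  -- the identities
  obtain ⟨h1, h2⟩ := orbitRow_identities N h01 333 166 hrow hpair O p hOcard x₀ hx₀O cls w hw hw' hfix
    (∑ y ∈ univ.filter (fun y => cls y = none), N x₀ y) rfl
  set σ := ∑ y ∈ univ.filter (fun y => cls y = none), N x₀ y with hσdef
  set m := Fintype.card {C // C ∈ T} with hmdef
  -- m p ≤ 667 : the classes are disjoint p-subsets of B
  have hmT : m = T.card := by rw [hmdef, Fintype.card_coe]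
  have hmp : m * p ≤ 667 := by
    have disj : (T : Set (Finset B)).PairwiseDisjoint id := by
      intro C hC C' hC' hne
      rw [Function.onFun, id, id, Finset.disjoint_left]
      intro y hy hy'
      apply hne
      obtain ⟨y₀, hy₀, rfl⟩ := Finset.mem_image.mp (Finset.mem_coe.mp hC)
      obtain ⟨y₁, hy₁, rfl⟩ := Finset.mem_image.mp (Finset.mem_coe.mp hC')
      have m0 := (Finset.mem_filter.mp hy₀).2
      have m1 := (Finset.mem_filter.mp hy₁).2
      rw [← orbFin_eq_of_mem τ hp hτ m0 hy, ← orbFin_eq_of_mem τ hp hτ m1 hy']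
    have hcard : (T.biUnion id).card = ∑ C ∈ T, (id C).card := Finset.card_biUnion disj
    have hle : (T.biUnion id).card ≤ 667 := by rw [← hB]; exact Finset.card_le_univ _
    have hsum : ∑ C ∈ T, (id C).card = T.card * p := by
      rw [Finset.sum_const_nat (m := p)]
      intro C hC
      obtain ⟨y₀, hy₀, rfl⟩ := Finset.mem_image.mp hC
      exact card_orbFin τ hp hτ (Finset.mem_filter.mp hy₀).2
    rw [hmT]; omega
  -- Cauchy–Schwarz on the second identity
  have cs := Finset.sum_mul_sq_le_sq_mul_sq (Finset.univ : Finset {C // C ∈ T}) w (fun _ => (1 : ℤ))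
  simp only [mul_one, one_pow, Finset.sum_const, Finset.card_univ, nsmul_eq_mul] at cs
  rw [← hmdef, h1] at cs
  have h2' : ∑ j, (w j) ^ 2 = 167 + 166 * (p : ℤ) - (p : ℤ) * σ := by linarith
  rw [h2'] at cs
  have hp43 : 43 ≤ p := primes106_ge p hmem
  by_cases hm0 : m = 0
  · -- no moved block: σ = 333 and p σ = 333 + 166 (p-1) force p = 1
    have hw0 : ∑ j, w j = 0 := by
      have : (Finset.univ : Finset {C // C ∈ T}) = ∅ := by
        rw [← Finset.card_eq_zero, Finset.card_univ, ← hmdef, hm0]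
      rw [this, Finset.sum_empty]
    have hw0' : ∑ j, (w j) ^ 2 = 0 := by
      have : (Finset.univ : Finset {C // C ∈ T}) = ∅ := by
        rw [← Finset.card_eq_zero, Finset.card_univ, ← hmdef, hm0]
      rw [this, Finset.sum_empty]
    rw [hw0] at h1; rw [hw0'] at h2
    have : (p : ℤ) ≥ 43 := by exact_mod_cast hp43
    nlinarith
  · have hm1 : 1 ≤ m := Nat.one_le_iff_ne_zero.mpr hm0
    have hm16 : m ∈ Finset.range 16 := by rw [Finset.mem_range]; nlinarith
    have hd := primes106_disc p hmem m hm16 hm1 hmp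
    nlinarith [sq_nonneg (2 * σ - (666 - (m : ℤ) * (p : ℤ))), cs, hd]

end Summit.Ventures.DiscreteObjects.Hadamard
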